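import Literature.AnabelianGeometry.SemiGraphs.TemperedAnabelian

/-!
# The geometric-origin hypothesis for the §6 interface; [SemiAnbd] Lem. 6.1–6.3, Thm. 6.5, 6.6 as printed

Mochizuki, *Semi-graphs of anabelioids*, Publ. RIMS **42** (2006) [SemiAnbd], §6, author's
manuscript pp. 69–73. [cite: MochizukiSemiAnbd2006, §6 pp.69-73]

`TemperedAnabelian.lean` types the §6 setting as the curve-level interface `TemperedCurve p`
(cell ruling η, abc-iut-L3-lead 2026-08-25T19:10:55Z: THE interface for curve-level consumers) and
Lemma 6.1 (ii)(iii), Lemma 6.3 (ii)(iii), Theorem 6.5 (i)–(iv), Theorem 6.6 as PREDICATES on a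
datum `X` ("`X` satisfies the conclusion of …").  The printed results are statements about the
tempered fundamental group OF A HYPERBOLIC CURVE over a finite extension of `ℚ_p`; for arbitrary
data satisfying the interface axioms they are false or meaningless, so they must not be asserted
`∀ X : TemperedCurve p`.  This file adds

* the ORIGIN hypothesis structure `TemperedOrigin p`: `Ω.IsHyperbolicCurveOrigin X` reads "`X` IS
  (`π₁^temp` with its augmentation, profinite completion and decomposition groups of) a hyperbolic
  curve `X_K` over the finite extension `K` of `ℚ_p`" (p. 69, p. 71) — an uninterpreted certificate
  carried as a PARAMETER and never constructed in wave 1 (consumer rule of the layer; the only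
  admissible instance is the future geometric one, at which the statements below become the printed
  theorems verbatim; a parameter rather than an `opaque` constant so that it can be instantiated);
* the printed, universally quantified statements `…Holds Ω := ∀ X, Ω.IsHyperbolicCurveOrigin X → …`
  of Lemma 6.1 (ii)(iii), Lemma 6.3 (ii)(iii), Theorem 6.5, Theorem 6.6 ("the fact is asserted only
  for certified `X`"; cell gate lesson G1).  Nothing is asserted.

Companion files over the same interface: `TemperedAnabelianMorphisms.lean` (Thm. 6.4, `DLoc`,
Def. 6.7 – Rmk. 6.9.1), `TemperedAbsoluteness.lean` (Cor. 6.10 – Rmk. 6.12.1), and the bridge to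
the group-level interface `TemperedArithmeticGroup K` of seat abc-iut-L3-t2 (`TemperedCurveBridge.lean`,
ruling η (4)).  No statement is strengthened; nothing here takes a side on [IUTchIII] Cor. 3.12.
-/

noncomputable section

namespace Literature.AnabelianGeometry.SemiGraphs

universe u

variable (p : ℕ) [Fact p.Prime]

/-- ORIGIN hypothesis structure for the curve-level interface ([SemiAnbd] §6 p. 69, p. 71):
`Ω.IsHyperbolicCurveOrigin X` reads "`K = X.K` is a finite extension of `ℚ_p` inside `K̄` and `X` IS
the datum (`Π^temp_{X_K} → G_K`, its profinite completion `Π_{X_K}`, the closed points of `X̄_K` with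
their decomposition groups) of a hyperbolic curve `X_K` over `K`".  Not definable in the tree
(FOUNDATIONS rows 12–13: André's `π₁^temp`, curves over `p`-adic fields); threaded as a parameter,
never constructed -- TODO-merge: abc-iut-L3-t2 / abc-iut-L4-t1 (a construction of `π₁^temp` turns
the certificate into a definition). [cite: MochizukiSemiAnbd2006, §6 p.69] -/
structure TemperedOrigin : Type 1 where
  /-- "`X` is (`π₁^temp` with decomposition groups of) a hyperbolic curve over a finite extension of
  `ℚ_p`" -/
  IsHyperbolicCurveOrigin : TemperedCurve p → Prop

namespace TemperedOrigin

variable {p}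

/-- **[SemiAnbd] Lemma 6.1 (ii), (iii)** (p. 69) as printed: for every hyperbolic curve `X_K` over a
finite extension `K` of `ℚ_p`, `N_{Δ_X}(Δ^temp_X) = Δ^temp_X` and
`N_{Π_{X_K}}(Π^temp_{X_K}) = Π^temp_{X_K}` (asserted only for certified `X`).
[cite: MochizukiSemiAnbd2006, Lem 6.1(ii)-(iii) p.69] -/
def ProfiniteNormalizersHolds (Ω : TemperedOrigin p) : Prop :=
  ∀ X : TemperedCurve p, Ω.IsHyperbolicCurveOrigin X →
    X.DeltaTempNormallyTerminal ∧ X.PiTempNormallyTerminal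

/-- **[SemiAnbd] Lemma 6.3 (ii), (iii)** (p. 70) as printed, for `F = Π^temp_{X_K}` and `F = Δ^temp_X`
of every hyperbolic curve over a finite extension of `ℚ_p` (asserted only for certified `X`).
[cite: MochizukiSemiAnbd2006, Lem 6.3(ii)-(iii) p.70] -/
def DenseSubgroupsHolds (Ω : TemperedOrigin p) : Prop :=
  ∀ X : TemperedCurve p, Ω.IsHyperbolicCurveOrigin X →
    X.PiTempDFGIffDOF ∧ X.DeltaTempDFGIffDOF ∧ X.PiTempDenseDOFConjugator ∧
      X.DeltaTempDenseDOFConjugator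

/-- **[SemiAnbd] Theorem 6.5 (i), (ii), (iv) (Tempered Decomposition Groups)** (pp. 71–72) as
printed: for every hyperbolic curve `X_K` over a finite extension of `ℚ_p` (asserted only for
certified `X`). [cite: MochizukiSemiAnbd2006, Thm 6.5 pp.71-72] -/
def TemperedDecompositionGroupsHolds (Ω : TemperedOrigin p) : Prop :=
  ∀ X : TemperedCurve p, Ω.IsHyperbolicCurveOrigin X →
    X.DecompDeterminesPoint ∧ X.InertiaDeterminesCusp ∧ X.DecompCommensurablyTerminal ∧
      X.DecompEqCommensuratorOfOpenInertia ∧ X.NoncuspidalNotLeCuspidal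

/-- **[SemiAnbd] Theorem 6.5 (iii) (Absoluteness of Cuspidal Decomposition Groups)** (p. 72) as
printed: for all hyperbolic curves `X_K`, `Y_L` over finite extensions of `ℚ_p` and every isomorphism
of tempered groups `α : Π^temp_{X_K} ≅ Π^temp_{Y_L}` (asserted only for certified `X`, `Y`).
[cite: MochizukiSemiAnbd2006, Thm 6.5(iii) p.72] -/
def CuspidalAbsolutenessHolds (Ω : TemperedOrigin p) : Prop :=
  ∀ X Y : TemperedCurve p, Ω.IsHyperbolicCurveOrigin X → Ω.IsHyperbolicCurveOrigin Y →
    X.IsoPreservesCuspidalDecomp Y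

/-- **[SemiAnbd] Theorem 6.6 (Tempered and Profinite Outer Isomorphisms)** (p. 72) as printed: for
all hyperbolic curves `X_K`, `Y_L` over finite extensions of `ℚ_p` (asserted only for certified
`X`, `Y`). [cite: MochizukiSemiAnbd2006, Thm 6.6 p.72] -/
def ProfiniteOuterIsoLiftsHolds (Ω : TemperedOrigin p) : Prop :=
  ∀ X Y : TemperedCurve p, Ω.IsHyperbolicCurveOrigin X → Ω.IsHyperbolicCurveOrigin Y →
    X.ProfiniteOuterIsoLifts Y

end TemperedOrigin

end Literature.AnabelianGeometry.SemiGraphs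

end
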